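/-
Copyright (c) 2026 the pub-hodgecm-mathlib formalisation cell (harness21).  Prover seat hodgecm-mathlib-LH7-p09 (g3), CLOSE-OUT ROSTER strike line L3∕L5 (Track A
«(D-RAM) FOUR-FRAME» squad F0∕P3c∕LH4 ∕ F0∕P3c∕LH7); β₂ WORD #30∕#34∕#36 «LH7-p09: hL_mix_hi» (lower line at `d ≤ b`: the cell-level letters, produced from the opened
‹OFF.letter.v2› block — twin of LH4-p19 (g3)'s ★ W2 `…UpperRayCellLetters.exists_cellLetters`), 2026-09-05.
-/
import Summits.HodgeConjecture.HodgeConjecture.Theorems.F0P3cDyRamUpperRayCellLetters      -- ★ p864626 (LH4-p19 (g3), W2): `exists_eq_add_two_mul_of_level` (parity, cell-generic); brings ★ p864286 F3 (centre ∕ slope identities, Eisenstein approximation), ★ Lit `v_eq_one_of_v_mul_map_eq_one`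
import HarnessLib

/-!
# Crux `H413`, line LH4 «(D-RAM) FOUR-FRAME» — STAGE-1b, row (2), the (β₂) road (R-36), (OFF) residue, LOWER line: «THE CELL LETTERS OF A LOWER-LINE CELL» — given the
# reference pair at `|ξ₀| = e^{2n}` (`j = b + 2n`), the centre `W`, the slope `BE`, and `σ`-fixed `γ₁, W₁` with the SLOPE letter `|BE∕(P·t₊) − γ₁| ≤ |γ₁|·|ϖ|^{2d−1}`, the ROOT
# letter `|γ₁(W − W₁)| ≤ |ϖ|^{2d−1}`, and the lower line's digit size `|γ₁| = 1`, `|W₁| ≤ 1`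

Cell `hodgecm-mathlib` (D-0151), FLOOR 0, crux item H413 = `stmt-HodgeConjecture-24833`, route of record `HCCMUnconditional`; squad F0∕P3c∕LH4 ∕ LH7; lane
`--supports stmt-HodgeConjecture-24833 --as helper` (count-neutral; pays NO tier-0 row).  THEOREMS ONLY (no `def`, no instance, no notation, no `sorry`, default heartbeats);
★-only imports; states NO law; (β₂) stays a HYPOTHESIS.  Frame = ★ W2's: opened ‹OFF.letter.v2› letters (the E-datum, the `jE`-letters, `ρ`, `Θ`, the line model's `lam` with
`Θlam·lam = 1`, `|lam| = 1`, `lam² = tr·lam − det`, `ρlam = tr − lam`, `det·σdet = 1`, the deep token `|lam − 1| ≤ |ϖE|^{3d−2}` (⟸ `_hlam1` at the floor `N ≥ m_c`), the `u`-entry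
(`uσu = 1`, `|u| = 1`), the sizes `|μ| = e^{−m}`, `|μ − ρμ| = e^{−jl}`, `μ = lam − jE u`), and the cell on the LOWER line: `j = b + 2n`, `j + b + d%2 = jl`, `2b + d%2 < m`, and the
floor `m_c = 3d − 2 + d%2 ≤ m` (spelled out).

WHY (β₂ sub-dealer LH4-p04 (g10) 02:08:26Z (b): road A = LH4-p19 (g3)'s R2 worker with `hdb : d ≤ b`; consumers ★ p864441 `…LowerLineVertexReads`, ★ `…LowerLineCellLiteralReads`
(R2b-B) and the R2 worker).  The lower-line vertex reads are stated against CELL-LEVEL constants exactly as on the upper line (★ W2): the reference pair `κ₀, ξ₀` (at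
`|ξ₀| = e^{j−b} = R`), the centre coordinate `W` (`jE W·ξ₀ = κ_c − κ₀`, `κ_c = ρμ∕(ρμ − μ)`), the slope `BE` (`jE BE = (μ − ρμ)ξ₀`), `P = (ϖσϖ)^b`, and `σ`-fixed Eisenstein
approximations `γ₁` of `θ = BE∕(P·t₊)` and `W₁` of `W`.  What changes is the ARITHMETIC: `jl = j + b + ℓ₀` gives `|BE| = e^{−2b−ℓ₀}` and **`|θ| = |γ₁| = 1`**;
`|κ_c| = e^{jl−m} = e^{2n+2b+ℓ₀−m} ≤ |ξ₀|` (`2b + ℓ₀ ≤ m`); `|W − σW| = |κ_c|·|μ|∕|ξ₀| = e^{2b+ℓ₀−2m}`, Eisenstein `|W − W₁| = e^{2b+ℓ₀−2m+d−1}`, so the ROOT letter reads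
`2m − 2b − ℓ₀ ≥ 3d − 2` ⟸ `m ≥ 2b + ℓ₀ + 1 ∧ m ≥ m_c` — TRUE ON THE WHOLE LOWER LINE under the fence (no band condition); the SLOPE letter is ★ W2's (`σθ = θ∕det`,
`|det − 1| ≤ |ϖ|^{3d−2}`, ★ F3 Eisenstein).
* HEAD `exists_cellLetters_lowerLine` — `∃ W BE γ₁ W₁` with: the centre and slope identities; `σγ₁ = γ₁`, `σW₁ = W₁`; SLOPE; ROOT; `|γ₁| = 1`; `|W₁| ≤ 1`.
WHAT IS NOT CLAIMED: the reference pair's existence at `|ξ₀| = e^{2n}` (★ F4, the worker's), the transfer letter `hγr` and the socket precisions (they involve `cc(α − ρα)`: the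
worker's one-liners from `|γ₁| = 1`, `|ξ₀|·|cc(α − ρα)| = |ϖE|^b`), any read, any count.
HONEST LABEL.  Count-neutral algebra; nothing printed is asserted; no census law is stated; `hL_ray`, ‹HL_MIX_HI›, ‹PRODBAL-L› stay OPEN; `HC_CM` is proved only modulo the
7 printed citations (2 remaining named inputs: hLiu418 = `stmt-HodgeConjecture-24832`, h413 = `stmt-HodgeConjecture-24833`) until rung 0 closes.
## References
* [Kottwitz1986BaseChangeUnits] R. E. Kottwitz, *Base change for unit elements of Hecke algebras*, Compositio Math. 60 (1986): §3 (the cell constants of a cone cell).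
* [Serre1979] J.-P. Serre, *Local Fields*, GTM 67 (1979): Ch. III §6 Prop. 12 (Eisenstein coordinates), Ch. V §3 (even valuation of fixed elements), Ch. XV §2.
* [Rogawski1990] J. D. Rogawski, *Automorphic Representations of Unitary Groups in Three Variables*, Ann. of Math. Stud. 123 (1990): §4.9 Prop. 4.9.1 (b) p. 55, §12.2.
-/

set_option autoImplicit false

noncomputable section

namespace Summit.HodgeConjecture.HodgeConjecture.Cruxes.H413.F0P3cDyRamLowerLineCellLetters

open scoped Valued WithZero
open WithZero
open Literature.NumberTheory.Automorphic.UnitaryThreeFourFrame (IsRamifiedQuadraticDatum)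
open Literature.NumberTheory.LocalFields.WildQuadraticDatum (v_eq_one_of_v_mul_map_eq_one)
open Literature.NumberTheory.Rogawski1990
open Summit.HodgeConjecture.HodgeConjecture.Cruxes.H413.F0P3cDyRamToricCensusDefs
open Summit.HodgeConjecture.HodgeConjecture.Cruxes.H413.F0P3cDyRamUpperLineCellCentre

variable {E M : Type} [Field E] [Valued E ℤᵐ⁰] [Field M] [Valued M ℤᵐ⁰] {ρ Θ : M →+* M}

/-- **HEAD — «THE CELL LETTERS OF A LOWER-LINE CELL».**  See the module docstring for the frame; `t₊ = (ϖ − σϖ)·((ϖσϖ)^{(d−d%2)∕2})⁻¹`, `P = (ϖσϖ)^b`, `μ = lam − jE u`; the cell: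
`j = b + 2n`, `j + b + d%2 = jl`, `2b + d%2 < m`, `3d − 2 + d%2 ≤ m`; the reference pair with `|κ₀| ≤ 1`, `|ξ₀| = e^{2n}`.  Outputs `W BE γ₁ W₁ : E` with:
`jE W·ξ₀ = ρμ∕(ρμ − μ) − κ₀`; `jE BE = (μ − ρμ)·ξ₀`; `σγ₁ = γ₁`; `σW₁ = W₁`; `|BE∕(P·t₊) − γ₁| ≤ |γ₁|·|ϖ|^{2d−1}`; `|γ₁(W − W₁)| ≤ |ϖ|^{2d−1}`; `|γ₁| = 1`; `|W₁| ≤ 1`.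
[cite: Kottwitz1986BaseChangeUnits, §3] [cite: Serre1979, Ch. III §6 Prop. 12; Ch. XV §2] [cite: Rogawski1990, §4.9 Prop. 4.9.1 (b) p. 55] -/
theorem exists_cellLetters_lowerLine {σ : E →+* E} {ϖ : E} {d tE : ℕ} (hD : IsRamifiedQuadraticDatum σ ϖ d tE)
    (jE : E →+* M) (hjiso : ∀ a, Valued.v (jE a) = Valued.v a) (hjfix : ∀ z, ρ z = z ↔ ∃ c, jE c = z) (hΘj : ∀ c, Θ (jE c) = jE (σ c))
    (hρρ : ∀ x, ρ (ρ x) = x) (hvρ : ∀ x, Valued.v (ρ x) = Valued.v x) (hΘρ : ∀ x, Θ (ρ x) = ρ (Θ x))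
    {lam : M} (hΘlam : Θ lam * lam = 1) (hvlam : Valued.v lam = 1)
    {tr det : E} (hdet : det * σ det = 1) (hlam2 : lam * lam = jE tr * lam - jE det) (hρlam : ρ lam = jE tr - lam)
    (hlam3 : Valued.v (lam - 1) ≤ Valued.v (jE ϖ) ^ (3 * d - 2))
    {u : E} (huu : u * σ u = 1) (hu : Valued.v u = 1)
    {m jl : ℕ} (hm : Valued.v (lam - jE u) = exp (-(m : ℤ))) (hjl : Valued.v ((lam - jE u) - ρ (lam - jE u)) = exp (-(jl : ℤ)))
    {j b n : ℕ} (hjbn : j = b + 2 * n) (hline : j + b + d % 2 = jl) (h2bm : 2 * b + d % 2 < m) (hmc : 3 * d - 2 + d % 2 ≤ m)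
    {κ₀ ξ₀ : M} (hκ₀ : κ₀ + ρ κ₀ = 1) (hΘκ₀ : Θ κ₀ = κ₀) (hξ : ρ ξ₀ = -ξ₀) (hΘξ : Θ ξ₀ = ξ₀) (hξ0 : ξ₀ ≠ 0)
    (hκ₀1 : Valued.v κ₀ ≤ 1) (hξv : Valued.v ξ₀ = exp (2 * (n : ℤ))) :
    ∃ W BE γ₁ W₁ : E,
      jE W * ξ₀ = ρ (lam - jE u) / (ρ (lam - jE u) - (lam - jE u)) - κ₀ ∧
      jE BE = ((lam - jE u) - ρ (lam - jE u)) * ξ₀ ∧ σ γ₁ = γ₁ ∧ σ W₁ = W₁ ∧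
      Valued.v (BE / ((ϖ * σ ϖ) ^ b * ((ϖ - σ ϖ) * ((ϖ * σ ϖ) ^ ((d - d % 2) / 2))⁻¹)) - γ₁) ≤ Valued.v γ₁ * Valued.v ϖ ^ (2 * d - 1) ∧
      Valued.v (γ₁ * (W - W₁)) ≤ Valued.v ϖ ^ (2 * d - 1) ∧
      Valued.v γ₁ = 1 ∧ Valued.v W₁ ≤ 1 := by
  obtain ⟨hσσ, hvσ, hϖ, -, hd, hd1, -⟩ := id hD
  have hvϖ0 : Valued.v ϖ ≠ 0 := by rw [hϖ]; exact exp_ne_zero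
  have hϖ0 : ϖ ≠ 0 := fun h0 => hvϖ0 (by rw [h0, map_zero])
  have hϖpos : (0 : ℤᵐ⁰) < Valued.v ϖ := zero_lt_iff.2 hvϖ0
  have hϖlt : Valued.v ϖ < 1 := by rw [hϖ, ← exp_zero, exp_lt_exp]; norm_num
  have hσϖ0 : σ ϖ ≠ 0 := (map_ne_zero σ).2 hϖ0
  have hPnE : ∀ k : ℕ, Valued.v ϖ ^ k = exp (-(k : ℤ)) := fun k => by rw [hϖ, ← exp_nsmul]; congr 1; simp
  have hρj : ∀ c : E, ρ (jE c) = jE c := fun c => (hjfix _).2 ⟨c, rfl⟩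
  have hϖσ : σ ϖ ≠ ϖ := fun h => by rw [h, sub_self, map_zero] at hd; exact pow_ne_zero _ hvϖ0 hd.symm
  have hjl2 : (jl : ℤ) = 2 * n + 2 * b + (d % 2 : ℕ) := by push_cast [hjbn] at hline ⊢; omega
  have hμρ : ρ (lam - jE u) ≠ lam - jE u := fun h => by
    rw [h, sub_self, map_zero] at hjl; exact exp_ne_zero hjl.symm
  have hξpos : (0 : ℤᵐ⁰) < Valued.v ξ₀ := zero_lt_iff.2 ((Valuation.ne_zero_iff _).2 hξ0)
  -- the centre coordinate and the slope
  obtain ⟨W, hWc⟩ := exists_centre_coord jE hjfix hρρ hμρ hκ₀ hξ hξ0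
  have hρB : ρ (((lam - jE u) - ρ (lam - jE u)) * ξ₀) = ((lam - jE u) - ρ (lam - jE u)) * ξ₀ := by
    rw [map_mul, map_sub, hρρ, hξ]; ring
  obtain ⟨BE, hBE⟩ := (hjfix _).1 hρB
  -- determinant letters
  have hdetv : Valued.v det = 1 := v_eq_one_of_v_mul_map_eq_one hvσ (by rw [hdet]; exact map_one _)
  have hdet0 : det ≠ 0 := fun h0 => by rw [h0, map_zero] at hdetv; exact zero_ne_one hdetv
  have hll : lam * ρ lam = jE det := by
    have e : lam * ρ lam = jE tr * lam - lam * lam := by rw [hρlam]; ring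
    rw [e, hlam2]; ring
  have hdet1 : Valued.v (det - 1) ≤ Valued.v ϖ ^ (3 * d - 2) := by
    rw [← hjiso, map_sub, map_one, ← hll, ← hjiso ϖ]
    have e : lam * ρ lam - 1 = (lam - 1) * ρ lam + ρ (lam - 1) := by rw [map_sub, map_one]; ring
    rw [e]
    refine (Valuation.map_add _ _ _).trans (max_le ?_ ?_)
    · rw [Valuation.map_mul, hvρ, hvlam, mul_one]; exact hlam3
    · rw [hvρ]; exact hlam3
  -- `σ` of the slope: `σB = −B ∕ det`
  have hl0 : lam ≠ 0 := fun h0 => by rw [h0, map_zero] at hvlam; exact zero_ne_one hvlam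
  have hρl0 : ρ lam ≠ 0 := fun h0 => hl0 (by rw [← hρρ lam, h0, map_zero])
  have hσBE : σ BE = -BE / det := jE.injective (by
    rw [← hΘj, map_div₀, map_neg, hBE, map_mul, hΘξ, ← hll, map_skew_eq_neg_div σ jE hΘj hρj hΘρ hΘlam huu]
    field_simp)
  set P : E := (ϖ * σ ϖ) ^ b with hPdef
  set tp : E := (ϖ - σ ϖ) * ((ϖ * σ ϖ) ^ ((d - d % 2) / 2))⁻¹ with htpdef
  have hσP : σ P = P := by rw [hPdef, map_pow, map_mul, hσσ, mul_comm (σ ϖ) ϖ]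
  have hσtp : σ tp = -tp := by
    rw [htpdef, map_mul, map_inv₀, map_pow, map_mul, map_sub, hσσ, mul_comm (σ ϖ) ϖ]; ring
  have hP0 : P ≠ 0 := pow_ne_zero _ (mul_ne_zero hϖ0 hσϖ0)
  have hPv : Valued.v P = Valued.v ϖ ^ (2 * b) := by rw [hPdef, Valuation.map_pow, Valuation.map_mul, hvσ, ← pow_two, ← pow_mul]
  have htpv : Valued.v tp = Valued.v ϖ ^ (d % 2) := by
    have h1 : Valued.v tp * Valued.v ϖ ^ (2 * ((d - d % 2) / 2)) = Valued.v ϖ ^ d := by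
      rw [htpdef, Valuation.map_mul, Valuation.map_inv, Valuation.map_pow, Valuation.map_mul, hvσ, ← pow_two, ← pow_mul, hd,
        inv_mul_cancel_right₀ (pow_ne_zero _ hvϖ0)]
    have h2 : Valued.v ϖ ^ d = Valued.v ϖ ^ (d % 2) * Valued.v ϖ ^ (2 * ((d - d % 2) / 2)) := by rw [← pow_add]; congr 1; omega
    exact mul_right_cancel₀ (pow_ne_zero _ hvϖ0) (h1.trans h2)
  have htp0 : tp ≠ 0 := fun h0 => by rw [h0, map_zero] at htpv; exact pow_ne_zero _ hvϖ0 htpv.symm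
  -- the slope ratio `θ` and its `σ`
  set θ : E := BE / (P * tp) with hθdef
  have hBE0 : BE ≠ 0 := fun h0 => by
    have : ((lam - jE u) - ρ (lam - jE u)) * ξ₀ = 0 := by rw [← hBE, h0, map_zero]
    exact mul_ne_zero (sub_ne_zero.2 (Ne.symm hμρ)) hξ0 this
  have hθ0 : θ ≠ 0 := div_ne_zero hBE0 (mul_ne_zero hP0 htp0)
  have hθpos : (0 : ℤᵐ⁰) < Valued.v θ := zero_lt_iff.2 ((Valuation.ne_zero_iff _).2 hθ0)
  have hσθ : σ θ = θ / det := by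
    rw [hθdef, map_div₀, map_mul, hσBE, hσP, hσtp]; field_simp
  have hθσv : Valued.v (θ - σ θ) ≤ Valued.v θ * Valued.v ϖ ^ (3 * d - 2) := by
    have e : θ - σ θ = θ * ((det - 1) / det) := by rw [hσθ]; field_simp
    rw [e, Valuation.map_mul, map_div₀ _ (det - 1) det, hdetv, div_one]; exact mul_le_mul' le_rfl hdet1
  -- Eisenstein approximation of the slope ratio
  obtain ⟨γ₁, hσγ, hγ⟩ := exists_fixed_v_sub_mul_eq hσσ hϖσ θ
  have hθγ : Valued.v (θ - γ₁) ≤ Valued.v θ * Valued.v ϖ ^ (2 * d - 1) := by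
    have h1 : Valued.v (θ - γ₁) * Valued.v ϖ ^ d ≤ Valued.v θ * Valued.v ϖ ^ (2 * d - 1) * Valued.v ϖ ^ d := by
      rw [← hd, hγ]
      calc Valued.v (θ - σ θ) * Valued.v ϖ ≤ Valued.v θ * Valued.v ϖ ^ (3 * d - 2) * Valued.v ϖ := mul_le_mul' hθσv le_rfl
        _ = Valued.v θ * Valued.v ϖ ^ (2 * d - 1) * Valued.v (ϖ - σ ϖ) := by
          rw [hd, mul_assoc, mul_assoc, ← pow_succ, ← pow_add]; congr 2; omega
    have h2 := (div_le_iff₀ (pow_pos hϖpos d)).2 h1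
    rwa [mul_div_assoc, div_self (pow_ne_zero _ hvϖ0), mul_one] at h2
  have h2d1 : Valued.v ϖ ^ (2 * d - 1) < 1 := pow_lt_one₀ zero_le hϖlt (by omega)
  have hθlt : Valued.v (θ - γ₁) < Valued.v θ :=
    hθγ.trans_lt (by
      calc Valued.v θ * Valued.v ϖ ^ (2 * d - 1) < Valued.v θ * 1 := mul_lt_mul_of_pos_left h2d1 hθpos
        _ = Valued.v θ := mul_one _)
  have hγv : Valued.v γ₁ = Valued.v θ := by
    have e : γ₁ = θ - (θ - γ₁) := by ring
    rw [e, Valuation.map_sub_eq_of_lt_left _ hθlt]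
  -- the size of `θ` on the LOWER line: `|BE| = e^{−2b−ℓ₀}` (`jl = 2n + 2b + ℓ₀`), `|P| = e^{−2b}`, `|t₊| = e^{−ℓ₀}` ⟹ `|θ| = 1`
  have hBEv : Valued.v BE = exp (-(jl : ℤ)) * exp (2 * (n : ℤ)) := by rw [← hjiso, hBE, Valuation.map_mul, hjl, hξv]
  have hθv : Valued.v θ = 1 := by
    rw [hθdef, Valuation.map_div, Valuation.map_mul, hBEv, hPv, htpv, hPnE, hPnE, ← exp_add, ← exp_add, ← exp_sub, ← exp_zero]
    congr 1; push_cast; omega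
  -- the root: `|κ_c| = e^{jl−m}`, `|W − σW| = |κ_c|·e^{−m}∕|ξ₀| = e^{2b+ℓ₀−2m}`, Eisenstein `W₁`
  have hκcv : Valued.v (ρ (lam - jE u) / (ρ (lam - jE u) - (lam - jE u))) = exp ((jl : ℤ) - m) := by
    rw [v_centre_eq hvρ (lam - jE u), hm, hjl, ← exp_sub]; congr 1; omega
  have hWσ : Valued.v (W - σ W) = exp (2 * (b : ℤ) + (d % 2 : ℕ) - 2 * m) := by
    have h1 := map_centre_coord_sub σ jE hΘj hΘκ₀ hΘξ hWc
    have h3 : ρ (lam - jE u) / (ρ (lam - jE u) - (lam - jE u)) - Θ (ρ (lam - jE u) / (ρ (lam - jE u) - (lam - jE u))) =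
        -(ρ (lam - jE u) / (ρ (lam - jE u) - (lam - jE u)) * ((lam - jE u) / jE u)) := by
      rw [← neg_sub, map_centre_sub_centre σ jE hΘj hρj hΘρ hΘlam huu hμρ]
    have h2 : Valued.v (W - σ W) * Valued.v ξ₀ = exp (2 * (b : ℤ) + (d % 2 : ℕ) - 2 * m) * Valued.v ξ₀ := by
      rw [← hjiso (W - σ W), ← Valuation.map_mul, h1.trans h3, Valuation.map_neg, Valuation.map_mul, hκcv, Valuation.map_div, hm,
        hjiso u, hu, div_one, hξv, ← exp_add, ← exp_add]
      congr 1; rw [hjl2]; push_cast; ring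
    exact mul_right_cancel₀ ((Valuation.ne_zero_iff _).2 hξ0) h2
  obtain ⟨W₁, hσW₁, hW1⟩ := exists_fixed_v_sub_mul_eq hσσ hϖσ W
  have hWWv : Valued.v (W - W₁) = exp (2 * (b : ℤ) + (d % 2 : ℕ) - 2 * m - 1 + d) := by
    have h1 : Valued.v (W - W₁) * exp (-(d : ℤ)) = exp (2 * (b : ℤ) + (d % 2 : ℕ) - 2 * m + (-1)) := by
      rw [← hPnE, ← hd, hW1, hWσ, hϖ, exp_add]
    rw [(eq_mul_inv_iff_mul_eq₀ exp_ne_zero).2 h1, ← exp_neg, ← exp_add]; congr 1; ring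
  have hWW : Valued.v (γ₁ * (W - W₁)) ≤ Valued.v ϖ ^ (2 * d - 1) := by
    rw [Valuation.map_mul, hγv, hθv, one_mul, hWWv, hPnE, exp_le_exp]; push_cast; omega
  have hWle : Valued.v W ≤ 1 := by
    have h1 : Valued.v (jE W) * Valued.v ξ₀ ≤ 1 * Valued.v ξ₀ := by
      rw [← Valuation.map_mul, hWc, one_mul]
      refine (Valuation.map_sub _ _ _).trans (max_le ?_ (hκ₀1.trans ?_))
      · rw [hκcv, hξv, exp_le_exp, hjl2]; push_cast; omega
      · rw [hξv, ← exp_zero, exp_le_exp]; omega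
    have h2 := (le_div_iff₀ hξpos).2 h1
    rwa [mul_div_assoc, div_self (ne_of_gt hξpos), mul_one, hjiso] at h2
  have hW₁1 : Valued.v W₁ ≤ 1 := by
    have e : W₁ = W - (W - W₁) := by ring
    rw [e]
    refine (Valuation.map_sub _ _ _).trans (max_le hWle ?_)
    rw [hWWv, ← exp_zero, exp_le_exp]; push_cast; omega
  have hγ1 : Valued.v γ₁ = 1 := by rw [hγv, hθv]
  exact ⟨W, BE, γ₁, W₁, hWc, hBE, hσγ, hσW₁, by rw [hγv]; exact hθγ, hWW, hγ1, hW₁1⟩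

end Summit.HodgeConjecture.HodgeConjecture.Cruxes.H413.F0P3cDyRamLowerLineCellLetters

end
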